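import Mathlib.FieldTheory.Finiteness
import Mathlib.LinearAlgebra.Dimension.Constructions
import Mathlib.LinearAlgebra.Dimension.Free
import Literature.NumberTheory.EllipticCurves.TateModuleProofs
import HarnessLib

/-!
# The Tate module of a group with `#A[p^n] = p^{dn}` is `ℤ_p^d` (Silverman, *AEC*, III.7.1, rank `d`)

Generic companion of `Literature.NumberTheory.EllipticCurves.TateModuleProofs` (which treats the
rank-`2` case of elliptic curves via `pairMap : ℤ_p × ℤ_p → T_p A`). Here the rank is a parameter
`d : ℕ`, as needed verbatim for abelian varieties (`d = 2g`,
`Literature.AlgebraicGeometry.Motives.AbelianVariety.finrank_tateModule_eq` / `finrank_rationalTateModule_eq` in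
`Literature.NumberTheory.DiophantineGeometry.AVGaloisModule`, from `natCard_geomTorsion`) and for
elliptic curves (`d = 2`, Silverman, *AEC*, Prop. III.7.1(a) from Cor. III.6.4(b) — the printed
proof "This follows immediately from (III.6.4b,c)").

## Main results (namespace `Literature.NumberTheory.EllipticCurves.TateModule`, any abelian group `A`, prime `p`, `d : ℕ`)

Hypothesis throughout: `hcard : ∀ n, Nat.card A[p^n] = p ^ (d * n)`.

* `mulP A p n : A[p^{n+1}] →+ A[p^n]` (multiplication by `p`) and `mulP_surjective` (counting: the
  kernel embeds in `A[p]` of order `p^d`); `proj_surjective_of_card`: the projections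
  `T_p A → A[p^n]` are onto (recursive lifting).
* `exists_generators_of_card`: `P₁, …, P_d ∈ T_p A` whose first components `ℤ`-span `A[p]`
  (an `𝔽_p`-basis of the `d`-dimensional `𝔽_p`-space `A[p]`, Mathlib `Module.finBasisOfFinrankEq`,
  lifted along `proj_surjective_of_card`).
* `span_level`: their `n`-th components then `ℤ`-span `A[p^n]` (induction on `n`);
  `finLevelMap P n : (ℤ/p^n)^d → A[p^n]` is onto, hence bijective by counting
  (`finLevelMap_bijective`).
* `coordMap P : ℤ_p^d →ₗ[ℤ_p] T_p A`, `v ↦ Σ vᵢ • Pᵢ`, is injective (`PadicInt.ext_of_toZModPow`)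
  and surjective (the compatible level coordinates glue through
  `Literature.TateModule.toPadicInt : lim← ℤ/p^k →+* ℤ_[p]` of `TateModuleProofs`).
* `nonempty_linearEquiv_of_card_torsionBy : Nonempty (T_p A ≃ₗ[ℤ_[p]] (Fin d → ℤ_[p]))`, whence
  `free_of_card_torsionBy_rank`, `finite_of_card_torsionBy_rank`,
  `finrank_eq_of_card_torsionBy : finrank ℤ_[p] (T_p A) = d`, and for `V_p A = ℚ_p ⊗ T_p A`
  `RationalTateModule.finrank_eq_of_card_torsionBy : finrank ℚ_[p] (V_p A) = d`
  (Mathlib `Module.finrank_baseChange`), `RationalTateModule.finite_of_card_torsionBy_rank`.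

The elliptic-curve specialisations (`d = 2`) are the theorems
`WeierstrassCurve.finrank_tateModule_eq_two_of_card_torsionPoints_eq_sq` and
`WeierstrassCurve.finrank_rationalTateModule_eq_two_of_card_torsionPoints_eq_sq` of
`TateModuleProofs` (reductions of the named facts `finrank_tateModule_eq_two`,
`finrank_rationalTateModule_eq_two` to `card_torsionPoints_eq_sq`, Silverman III.6.4(b)).

## References

* [SilvermanAEC2009] J. H. Silverman, *The Arithmetic of Elliptic Curves*, 2nd ed., GTM 106,
  Springer 2009, Prop. III.7.1(a) and Remark 7.2, Cor. III.6.4(b) (III.§6–§7).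
* D. Mumford, *Abelian Varieties*, §18–19 (`T_ℓ A ≅ ℤ_ℓ^{2g}` from `#A[ℓ^n] = ℓ^{2gn}`).
-/

noncomputable section

open scoped Classical
open scoped AddSubgroup TensorProduct

universe u

namespace Literature.NumberTheory.EllipticCurves

namespace TateModule

variable {A : Type u} [AddCommGroup A] {p : ℕ}

/-! ### Elementary lemmas on compatible sequences -/

/-- `p^n • a_{n+1} = a_1` (the case `m = n`, base index `1` of `pow_smul_proj_add`). [folklore] -/
theorem pow_smul_proj_succ (n : ℕ) (a : TateModule A p) :
    p ^ n • proj p (n + 1) a = proj p 1 a := by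
  rw [show n + 1 = 1 + n from Nat.add_comm n 1, pow_smul_proj_add]

section Prime

variable [Fact p.Prime]

/-! ### Surjectivity of `[p] : A[p^{n+1}] → A[p^n]` and of the projections, from the counting
hypothesis `#A[p^n] = p^{dn}` -/

variable (A p) in
/-- Multiplication by `p` as a map `A[p^{n+1}] →+ A[p^n]` (the transition map of the inverse system
defining `T_p A`). Silverman, *AEC*, III.§7. [folklore] -/
def mulP (n : ℕ) : A[(p ^ (n + 1) : ℕ)] →+ A[(p ^ n : ℕ)] where
  toFun x := ⟨p • (x : A), by
    apply AddSubgroup.torsionBy.nsmul_iff.mpr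
    rw [← mul_smul, ← pow_succ]
    exact AddSubgroup.torsionBy.nsmul_iff.mp x.2⟩
  map_zero' := Subtype.ext (smul_zero p)
  map_add' x y := Subtype.ext (smul_add p (x : A) y)

omit [Fact p.Prime] in
/-- Unfolding `mulP`: `(mulP n x : A) = p • x`. [folklore] -/
theorem coe_mulP (n : ℕ) (x : A[(p ^ (n + 1) : ℕ)]) : (mulP A p n x : A) = p • (x : A) := rfl

variable {d : ℕ}

/-- Under `#A[p^n] = p^{dn}`, each `A[p^n]` is finite. [folklore] -/
theorem finite_torsionBy_of_card (hcard : ∀ n, Nat.card (A[(p ^ n : ℕ)]) = p ^ (d * n)) (n : ℕ) :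
    Finite (A[(p ^ n : ℕ)]) :=
  Nat.finite_of_card_ne_zero (by rw [hcard n]; exact pow_ne_zero _ (Fact.out : p.Prime).ne_zero)

omit [Fact p.Prime] in
/-- `#A[p] = p^d` (the case `n = 1` of the counting hypothesis). [folklore] -/
theorem card_torsionBy_one_of_card (hcard : ∀ n, Nat.card (A[(p ^ n : ℕ)]) = p ^ (d * n)) :
    Nat.card (A[(p : ℕ)]) = p ^ d := by
  simpa using hcard 1

/-- Counting argument: if `#A[p^n] = p^{dn}` for all `n`, then `[p] : A[p^{n+1}] → A[p^n]` is
surjective (its kernel embeds in `A[p]`, of order `p^d`). Silverman, *AEC*, III.§7 ("since the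
multiplication-by-`ℓ` maps are surjective"). [folklore] -/
theorem mulP_surjective (hcard : ∀ n, Nat.card (A[(p ^ n : ℕ)]) = p ^ (d * n)) (n : ℕ) :
    Function.Surjective (mulP A p n) := by
  have hp : p.Prime := Fact.out
  haveI := finite_torsionBy_of_card hcard n
  haveI := finite_torsionBy_of_card hcard (n + 1)
  haveI := finite_torsionBy_of_card hcard 1
  have h1 : Nat.card (A[(p ^ 1 : ℕ)]) = p ^ d := by rw [hcard 1, mul_one]
  -- the kernel embeds into `A[p^1]`
  have hK : Nat.card (mulP A p n).ker ≤ p ^ d := by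
    have hmem : ∀ x : (mulP A p n).ker, ((x : A[(p ^ (n + 1) : ℕ)]) : A) ∈ A[(p ^ 1 : ℕ)] := by
      intro x
      have hx := congrArg (fun z : A[(p ^ n : ℕ)] ↦ (z : A)) ((AddMonoidHom.mem_ker).mp x.2)
      simp only [coe_mulP, ZeroMemClass.coe_zero] at hx
      apply AddSubgroup.torsionBy.nsmul_iff.mpr
      rw [pow_one, hx]
    let ι : (mulP A p n).ker → A[(p ^ 1 : ℕ)] := fun x ↦ ⟨((x : A[(p ^ (n + 1) : ℕ)]) : A), hmem x⟩
    have hι : Function.Injective ι := by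
      intro x y hxy
      have h' := congrArg Subtype.val hxy
      exact Subtype.ext (Subtype.ext h')
    have hle := Nat.card_le_card_of_injective ι hι
    rwa [h1] at hle
  have hR : Nat.card (mulP A p n).range ≤ Nat.card (A[(p ^ n : ℕ)]) :=
    Nat.card_le_card_of_injective _ Subtype.val_injective
  have hKR : Nat.card (mulP A p n).ker * Nat.card (mulP A p n).range =
      p ^ d * Nat.card (A[(p ^ n : ℕ)]) := by
    rw [← AddSubgroup.index_ker, AddSubgroup.card_mul_index, hcard (n + 1), hcard n]; ring
  have hReq : Nat.card (mulP A p n).range = Nat.card (A[(p ^ n : ℕ)]) := by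
    by_contra hne
    have hlt := lt_of_le_of_ne hR hne
    have hlt' : Nat.card (mulP A p n).ker * Nat.card (mulP A p n).range <
        p ^ d * Nat.card (A[(p ^ n : ℕ)]) :=
      calc Nat.card (mulP A p n).ker * Nat.card (mulP A p n).range
            ≤ p ^ d * Nat.card (mulP A p n).range := Nat.mul_le_mul_right _ hK
        _ < p ^ d * Nat.card (A[(p ^ n : ℕ)]) := Nat.mul_lt_mul_of_pos_left hlt (pow_pos hp.pos d)
    exact hlt'.ne hKR
  exact AddMonoidHom.range_eq_top.mp (AddSubgroup.eq_top_of_card_eq _ hReq)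

/-- Recursive lifting along the surjections `[p]`: from `x ∈ A[p^n]`, a sequence `Q_k ∈ A[p^{n+k}]`
with `Q_0 = x`, `p • Q_{k+1} = Q_k`. [folklore] -/
private def liftSeqFrom (hs : ∀ m, Function.Surjective (mulP A p m)) (n : ℕ) (x : A[(p ^ n : ℕ)]) :
    (k : ℕ) → A[(p ^ (n + k) : ℕ)]
  | 0 => x
  | k + 1 => Classical.choose (hs (n + k) (liftSeqFrom hs n x k))

omit [Fact p.Prime] in
/-- `p • Q_{k+1} = Q_k` for the lifted sequence. [folklore] -/
private theorem smul_liftSeqFrom_succ (hs : ∀ m, Function.Surjective (mulP A p m)) (n : ℕ)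
    (x : A[(p ^ n : ℕ)]) (k : ℕ) :
    p • (liftSeqFrom hs n x (k + 1) : A) = liftSeqFrom hs n x k := by
  rw [liftSeqFrom]
  exact congrArg (fun z : A[(p ^ (n + k) : ℕ)] ↦ (z : A))
    (Classical.choose_spec (hs (n + k) (liftSeqFrom hs n x k)))

omit [Fact p.Prime] in
/-- `p^k • Q_{j+k} = Q_j` for the lifted sequence. [folklore] -/
private theorem pow_smul_liftSeqFrom_add (hs : ∀ m, Function.Surjective (mulP A p m)) (n : ℕ)
    (x : A[(p ^ n : ℕ)]) (k j : ℕ) :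
    p ^ k • (liftSeqFrom hs n x (j + k) : A) = liftSeqFrom hs n x j := by
  induction k with
  | zero => simp
  | succ k ih =>
    rw [pow_succ, mul_smul]
    change p ^ k • p • (liftSeqFrom hs n x (j + k + 1) : A) = _
    rw [smul_liftSeqFrom_succ, ih]

/-- If `#A[p^n] = p^{dn}` for all `n`, the projections `T_p A → A[p^n]` are surjective: every
`p^n`-torsion element is the `n`-th component of a compatible sequence.
Silverman, *AEC*, III.§7. [folklore] -/
theorem proj_surjective_of_card (hcard : ∀ n, Nat.card (A[(p ^ n : ℕ)]) = p ^ (d * n)) (n : ℕ)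
    {x : A} (hx : x ∈ A[(p ^ n : ℕ)]) : ∃ a : TateModule A p, proj p n a = x := by
  have hs := mulP_surjective hcard
  let Q := liftSeqFrom hs n ⟨x, hx⟩
  refine ⟨mk (fun m ↦ p ^ n • (Q m : A)) (fun m ↦ ?_) (fun m ↦ ?_), ?_⟩
  · rw [← mul_smul, ← pow_add, add_comm]
    exact AddSubgroup.torsionBy.nsmul_iff.mp (Q m).2
  · rw [smul_comm, smul_liftSeqFrom_succ]
  · rw [proj_mk]
    have := pow_smul_liftSeqFrom_add hs n ⟨x, hx⟩ n 0
    rw [Nat.zero_add] at this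
    rw [this]; rfl

/-! ### An `𝔽_p`-basis of `A[p]`, lifted to `T_p A` -/

/-- If `#A[p^n] = p^{dn}` for all `n`, there are `P_1, …, P_d ∈ T_p A` whose first components
`ℤ`-span `A[p]` (lift an `𝔽_p`-basis of the `d`-dimensional `𝔽_p`-space `A[p]`). [folklore] -/
theorem exists_generators_of_card (hcard : ∀ n, Nat.card (A[(p ^ n : ℕ)]) = p ^ (d * n)) :
    ∃ P : Fin d → TateModule A p,
      ∀ x ∈ A[(p : ℕ)], ∃ z : Fin d → ℤ, x = ∑ i, z i • proj p 1 (P i) := by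
  have hp : p.Prime := Fact.out
  letI : Module (ZMod p) (A[(p : ℕ)]) := AddSubgroup.torsionBy.zmodModule
  haveI : Finite (A[(p : ℕ)]) := by simpa using finite_torsionBy_of_card hcard 1
  have hrank : Module.finrank (ZMod p) (A[(p : ℕ)]) = d := by
    have h := Module.natCard_eq_pow_finrank (K := ZMod p) (V := A[(p : ℕ)])
    rw [Nat.card_zmod, card_torsionBy_one_of_card hcard] at h
    exact (Nat.pow_right_injective hp.two_le h).symm
  let B := Module.finBasisOfFinrankEq (ZMod p) (A[(p : ℕ)]) hrank
  -- lift each basis vector to `T_p A`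
  have hlift : ∀ i, ∃ a : TateModule A p, proj p 1 a = (B i : A) := fun i ↦
    proj_surjective_of_card hcard 1 (by rw [pow_one]; exact (B i).2)
  choose P hP using hlift
  refine ⟨P, fun x hx ↦ ⟨fun i ↦ ((B.repr ⟨x, hx⟩ i).val : ℤ), ?_⟩⟩
  have hsum : x = ∑ i, ((B.repr ⟨x, hx⟩ i • B i : A[(p : ℕ)]) : A) := by
    rw [← AddSubmonoidClass.coe_finsetSum, B.sum_repr ⟨x, hx⟩]
  calc x = ∑ i, ((B.repr ⟨x, hx⟩ i • B i : A[(p : ℕ)]) : A) := hsum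
    _ = ∑ i, ((B.repr ⟨x, hx⟩ i).val : ℤ) • proj p 1 (P i) := Finset.sum_congr rfl fun i _ ↦ by
      rw [hP i, natCast_zsmul, ← AddSubgroupClass.coe_nsmul, ← Nat.cast_smul_eq_nsmul (ZMod p),
        ZMod.natCast_zmod_val]

/-! ### Level-`n` coordinates -/

section Generators

variable (P : Fin d → TateModule A p)

omit [Fact p.Prime] in
/-- If the first components of `P_1, …, P_d ∈ T_p A` `ℤ`-span `A[p]`, then their `n`-th components
`ℤ`-span `A[p^n]`, for every `n` (induction on `n`). [folklore] -/
theorem span_level (hP : ∀ x ∈ A[(p : ℕ)], ∃ z : Fin d → ℤ, x = ∑ i, z i • proj p 1 (P i))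
    (n : ℕ) : ∀ x ∈ A[(p ^ n : ℕ)], ∃ z : Fin d → ℤ, x = ∑ i, z i • proj p n (P i) := by
  induction n with
  | zero =>
    intro x hx
    have hx0 : x = 0 := by simpa using AddSubgroup.torsionBy.nsmul_iff.mp hx
    exact ⟨0, by simp [hx0]⟩
  | succ n ih =>
    intro x hx
    have hx' : p ^ (n + 1) • x = 0 := AddSubgroup.torsionBy.nsmul_iff.mp hx
    have h1 : p ^ n • x ∈ A[(p : ℕ)] := by
      apply AddSubgroup.torsionBy.nsmul_iff.mpr
      rw [← mul_smul, ← pow_succ', hx']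
    obtain ⟨c, hc⟩ := hP _ h1
    set y := x - ∑ i, c i • proj p (n + 1) (P i) with hy_def
    have hy : y ∈ A[(p ^ n : ℕ)] := by
      apply AddSubgroup.torsionBy.nsmul_iff.mpr
      rw [hy_def, smul_sub, hc, Finset.smul_sum, sub_eq_zero]
      refine Finset.sum_congr rfl fun i _ ↦ ?_
      rw [smul_comm, pow_smul_proj_succ]
    obtain ⟨e, he⟩ := ih y hy
    refine ⟨fun i ↦ e i * p + c i, ?_⟩
    have hx_eq : x = y + ∑ i, c i • proj p (n + 1) (P i) := by rw [hy_def, sub_add_cancel]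
    rw [hx_eq, he, ← Finset.sum_add_distrib]
    refine Finset.sum_congr rfl fun i _ ↦ ?_
    rw [add_smul, mul_smul, natCast_zsmul, smul_proj_succ]

variable (n : ℕ)

/-- The level-`n` coordinate map `(ℤ/p^n)^d → A[p^n]`, `c ↦ Σ cᵢ • (Pᵢ)_n`. [folklore] -/
def finLevelMap (c : Fin d → ZMod (p ^ n)) : A[(p ^ n : ℕ)] :=
  ⟨∑ i, (c i).val • proj p n (P i),
    sum_mem fun i _ ↦ AddSubgroup.nsmul_mem _ (proj_mem_torsionBy n (P i)) _⟩

omit [Fact p.Prime] in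
/-- Unfolding `finLevelMap`. [folklore] -/
@[simp]
theorem coe_finLevelMap (c : Fin d → ZMod (p ^ n)) :
    (finLevelMap P n c : A) = ∑ i, (c i).val • proj p n (P i) := rfl

variable {P n}

/-- The level-`n` coordinate map is surjective when the first components span `A[p]`. [folklore] -/
theorem finLevelMap_surjective
    (hP : ∀ x ∈ A[(p : ℕ)], ∃ z : Fin d → ℤ, x = ∑ i, z i • proj p 1 (P i)) (n : ℕ) :
    Function.Surjective (finLevelMap P n) := by
  rintro ⟨x, hx⟩
  obtain ⟨z, hz⟩ := span_level P hP n x hx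
  refine ⟨fun i ↦ (z i : ZMod (p ^ n)), Subtype.ext ?_⟩
  change (finLevelMap P n _ : A) = x
  rw [coe_finLevelMap, hz]
  refine Finset.sum_congr rfl fun i _ ↦ ?_
  exact val_intCast_smul_of_mem_torsionBy (proj_mem_torsionBy n (P i)) (z i)

/-- Counting: the level-`n` coordinate map `(ℤ/p^n)^d → A[p^n]` is bijective when the first
components span `A[p]` and `#A[p^n] = p^{dn}`. Silverman, *AEC*, III.6.4(b) ⇒ III.7.1. [folklore] -/
theorem finLevelMap_bijective (hcard : ∀ n, Nat.card (A[(p ^ n : ℕ)]) = p ^ (d * n))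
    (hP : ∀ x ∈ A[(p : ℕ)], ∃ z : Fin d → ℤ, x = ∑ i, z i • proj p 1 (P i)) (n : ℕ) :
    Function.Bijective (finLevelMap P n) := by
  refine (finLevelMap_surjective hP n).bijective_of_nat_card_le (le_of_eq ?_)
  rw [Nat.card_fun, Nat.card_zmod, Nat.card_fin, hcard n, ← pow_mul, mul_comm]

/-- Uniqueness of level-`n` coordinates. [folklore] -/
theorem finLevelMap_ext (hcard : ∀ n, Nat.card (A[(p ^ n : ℕ)]) = p ^ (d * n))
    (hP : ∀ x ∈ A[(p : ℕ)], ∃ z : Fin d → ℤ, x = ∑ i, z i • proj p 1 (P i)) {n : ℕ}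
    {c c' : Fin d → ZMod (p ^ n)}
    (h : ∑ i, (c i).val • proj p n (P i) = ∑ i, (c' i).val • proj p n (P i)) : c = c' :=
  (finLevelMap_bijective hcard hP n).injective (Subtype.ext h)

/-! ### The comparison map `ℤ_p^d → T_p A` -/

variable (P) in
/-- The `ℤ_p`-linear map `ℤ_p^d → T_p A`, `v ↦ Σ vᵢ • Pᵢ`. [folklore] -/
def coordMap : (Fin d → ℤ_[p]) →ₗ[ℤ_[p]] TateModule A p :=
  Fintype.linearCombination ℤ_[p] P

/-- Components of `coordMap`: `(Σ vᵢ • Pᵢ)_n = Σ (vᵢ mod p^n) • (Pᵢ)_n`. [folklore] -/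
theorem proj_coordMap (v : Fin d → ℤ_[p]) (n : ℕ) :
    proj p n (coordMap P v) = ∑ i, (PadicInt.toZModPow n (v i)).val • proj p n (P i) := by
  simp [coordMap, Fintype.linearCombination_apply, map_sum]

/-- `ℤ_p^d → T_p A` is injective (compare level-`n` coordinates and use
`PadicInt.ext_of_toZModPow`). [folklore] -/
theorem coordMap_injective (hcard : ∀ n, Nat.card (A[(p ^ n : ℕ)]) = p ^ (d * n))
    (hP : ∀ x ∈ A[(p : ℕ)], ∃ z : Fin d → ℤ, x = ∑ i, z i • proj p 1 (P i)) :
    Function.Injective (coordMap P) := by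
  refine (injective_iff_map_eq_zero _).mpr fun v hv ↦ ?_
  funext i
  refine PadicInt.ext_of_toZModPow.mp fun n ↦ ?_
  have h := congrArg (proj p n) hv
  rw [proj_coordMap, map_zero] at h
  have hc : (fun i ↦ PadicInt.toZModPow n (v i)) = fun _ ↦ (0 : ZMod (p ^ n)) :=
    finLevelMap_ext hcard hP (by rw [h]; simp)
  simpa using congrFun hc i

/-- Level-`n` coordinates of an element of `T_p A`. [folklore] -/
private def levelCoord (hcard : ∀ n, Nat.card (A[(p ^ n : ℕ)]) = p ^ (d * n))
    (hP : ∀ x ∈ A[(p : ℕ)], ∃ z : Fin d → ℤ, x = ∑ i, z i • proj p 1 (P i))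
    (a : TateModule A p) (n : ℕ) : Fin d → ZMod (p ^ n) :=
  Classical.choose ((finLevelMap_bijective hcard hP n).surjective ⟨proj p n a, proj_mem_torsionBy n a⟩)

/-- Defining property of the level-`n` coordinates. [folklore] -/
private theorem levelCoord_spec (hcard : ∀ n, Nat.card (A[(p ^ n : ℕ)]) = p ^ (d * n))
    (hP : ∀ x ∈ A[(p : ℕ)], ∃ z : Fin d → ℤ, x = ∑ i, z i • proj p 1 (P i))
    (a : TateModule A p) (n : ℕ) :
    ∑ i, (levelCoord hcard hP a n i).val • proj p n (P i) = proj p n a := by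
  have := Classical.choose_spec
    ((finLevelMap_bijective hcard hP n).surjective ⟨proj p n a, proj_mem_torsionBy n a⟩)
  exact congrArg (fun z : A[(p ^ n : ℕ)] ↦ (z : A)) this

/-- The level coordinates are compatible under reduction `ℤ/p^m → ℤ/p^n`. [folklore] -/
private theorem cast_levelCoord (hcard : ∀ n, Nat.card (A[(p ^ n : ℕ)]) = p ^ (d * n))
    (hP : ∀ x ∈ A[(p : ℕ)], ∃ z : Fin d → ℤ, x = ∑ i, z i • proj p 1 (P i))
    (a : TateModule A p) {n m : ℕ} (hnm : n ≤ m) (i : Fin d) :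
    (ZMod.cast (levelCoord hcard hP a m i) : ZMod (p ^ n)) = levelCoord hcard hP a n i := by
  obtain ⟨k, rfl⟩ := Nat.exists_eq_add_of_le hnm
  have key : (fun i ↦ (ZMod.cast (levelCoord hcard hP a (n + k) i) : ZMod (p ^ n))) =
      levelCoord hcard hP a n := by
    refine finLevelMap_ext hcard hP ?_
    rw [levelCoord_spec, ← pow_smul_proj_add a n k, ← levelCoord_spec hcard hP a (n + k), Finset.smul_sum]
    refine Finset.sum_congr rfl fun i _ ↦ ?_
    rw [smul_comm, pow_smul_proj_add, ZMod.cast_eq_val, ZMod.val_natCast,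
      ← AddSubgroup.torsionBy.mod_self_nsmul' _ (proj_mem_torsionBy n (P i))]
  exact congrFun key i

/-- `ℤ_p^d → T_p A` is surjective: the compatible level coordinates of `a ∈ T_p A` glue to elements
of `ℤ_p = lim← ℤ/p^n` (`Literature.NumberTheory.EllipticCurves.TateModule.toPadicInt`, Mathlib `PadicInt.lift`). [folklore] -/
theorem coordMap_surjective (hcard : ∀ n, Nat.card (A[(p ^ n : ℕ)]) = p ^ (d * n))
    (hP : ∀ x ∈ A[(p : ℕ)], ∃ z : Fin d → ℤ, x = ∑ i, z i • proj p 1 (P i)) :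
    Function.Surjective (coordMap P) := by
  intro a
  let c := levelCoord hcard hP a
  -- for each `i`, the compatible family `n ↦ c n i`, glued to an element of `ℤ_[p]`
  let s : Fin d → compatSeqSubring p := fun i ↦
    ⟨fun k ↦ c k i, fun m n h ↦ by rw [ZMod.castHom_apply]; exact cast_levelCoord hcard hP a h i⟩
  refine ⟨fun i ↦ toPadicInt p (s i), TateModule.ext fun n ↦ ?_⟩
  rw [proj_coordMap]
  simp only [toZModPow_toPadicInt]
  exact levelCoord_spec hcard hP a n

end Generators

/-! ### The structure theorem -/

/-- **Structure of the Tate module from torsion counts.** If `#A[p^n] = p^{dn}` for all `n`, then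
`T_p A ≅ ℤ_p^d` as `ℤ_p`-modules. For `A = E(K̄)`, `d = 2`, `p ≠ char K` this is Silverman, *AEC*,
Prop. III.7.1(a) deduced from Cor. III.6.4(b), exactly as in the printed proof.
[cite: SilvermanAEC2009, Prop. III.7.1(a)] -/
theorem nonempty_linearEquiv_of_card_torsionBy
    (hcard : ∀ n, Nat.card (A[(p ^ n : ℕ)]) = p ^ (d * n)) :
    Nonempty (TateModule A p ≃ₗ[ℤ_[p]] (Fin d → ℤ_[p])) := by
  obtain ⟨P, hP⟩ := exists_generators_of_card hcard
  exact ⟨(LinearEquiv.ofBijective (coordMap P)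
    ⟨coordMap_injective hcard hP, coordMap_surjective hcard hP⟩).symm⟩

/-- If `#A[p^n] = p^{dn}` for all `n`, then `T_p A` is a free `ℤ_p`-module.
[cite: SilvermanAEC2009, Prop. III.7.1(a)] -/
theorem free_of_card_torsionBy_rank (hcard : ∀ n, Nat.card (A[(p ^ n : ℕ)]) = p ^ (d * n)) :
    Module.Free ℤ_[p] (TateModule A p) := by
  obtain ⟨e⟩ := nonempty_linearEquiv_of_card_torsionBy hcard
  exact Module.Free.of_equiv e.symm

/-- If `#A[p^n] = p^{dn}` for all `n`, then `T_p A` is a finitely generated `ℤ_p`-module.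
[cite: SilvermanAEC2009, Prop. III.7.1(a)] -/
theorem finite_of_card_torsionBy_rank (hcard : ∀ n, Nat.card (A[(p ^ n : ℕ)]) = p ^ (d * n)) :
    Module.Finite ℤ_[p] (TateModule A p) := by
  obtain ⟨e⟩ := nonempty_linearEquiv_of_card_torsionBy hcard
  exact Module.Finite.equiv e.symm

/-- If `#A[p^n] = p^{dn}` for all `n`, then `rank_{ℤ_p} T_p A = d`.
[cite: SilvermanAEC2009, Prop. III.7.1(a)] -/
theorem finrank_eq_of_card_torsionBy (hcard : ∀ n, Nat.card (A[(p ^ n : ℕ)]) = p ^ (d * n)) :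
    Module.finrank ℤ_[p] (TateModule A p) = d := by
  obtain ⟨e⟩ := nonempty_linearEquiv_of_card_torsionBy hcard
  rw [e.finrank_eq, Module.finrank_fintype_fun_eq_card, Fintype.card_fin]

end Prime

end TateModule

namespace RationalTateModule

variable {A : Type u} [AddCommGroup A] {p : ℕ} [Fact p.Prime] {d : ℕ}

/-- If `#A[p^n] = p^{dn}` for all `n`, then `dim_{ℚ_p} V_p A = d` (`V_p A = ℚ_p ⊗ T_p A` with
`T_p A ≅ ℤ_p^d`). Silverman, *AEC*, III.7.1(a) with Remark 7.2.
[cite: SilvermanAEC2009, Prop. III.7.1(a) and Remark 7.2] -/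
theorem finrank_eq_of_card_torsionBy (hcard : ∀ n, Nat.card (A[(p ^ n : ℕ)]) = p ^ (d * n)) :
    Module.finrank ℚ_[p] (RationalTateModule A p) = d := by
  haveI := TateModule.free_of_card_torsionBy_rank hcard
  haveI := TateModule.finite_of_card_torsionBy_rank hcard
  change Module.finrank ℚ_[p] (ℚ_[p] ⊗[ℤ_[p]] TateModule A p) = d
  rw [Module.finrank_baseChange, TateModule.finrank_eq_of_card_torsionBy hcard]

/-- If `#A[p^n] = p^{dn}` for all `n`, then `V_p A` is finite-dimensional over `ℚ_p`. [folklore] -/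
theorem finite_of_card_torsionBy_rank (hcard : ∀ n, Nat.card (A[(p ^ n : ℕ)]) = p ^ (d * n)) :
    Module.Finite ℚ_[p] (RationalTateModule A p) := by
  haveI := TateModule.finite_of_card_torsionBy_rank hcard
  change Module.Finite ℚ_[p] (ℚ_[p] ⊗[ℤ_[p]] TateModule A p)
  infer_instance

end RationalTateModule

end Literature.NumberTheory.EllipticCurves
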